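import Summits.ResolutionOfSingularities.ResolutionOfSingularities.Theorems.FrobeniusLadderFInjectiveMacaulayficationFullLastCentreFibre
import HarnessLib

/-!
# K10k — THE LINEAR COORDINATE-CHANGE STEP: graded letter substitutions fixing the exceptional letters preserve the residual decomposition, the residual order, the slacks
# and the drop-point budget; equi-ω chains WITH linear re-coordinatisations and fibre points stay tame
# (crux `FInjectiveMacaulayfication` stmt-ResolutionOfSingularities-15315, chain w45a; desk ruling R26.47 (3): «(g1) — LINEAR changes among non-exceptional letters are within the
# polynomial `Stage` model: type that»; seat res-L1-w45a-lead-1 g16)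

[OURS · L1 W4.5a] Support file (`--supports stmt-ResolutionOfSingularities-15315 --as helper`); replaces the role of NO printed item; NOT a statement of any manuscript;
proves nothing of the crux; OURS counted 0. AI-written (AI review is weaker than expert review).

SCOPE SENTENCE (R26.47 (3)). The typed layer treats centres that are AFFINE-LINEAR in the current letters: after a translation (K10i) and an invertible LINEAR letter
substitution `y_n ↦ Σ_m A_{nm} y_m` fixing every exceptional letter (`linMap A`, `IsLinChange`), the centre is a coordinate subspace `V(x, y_Nor)` and K10–K10j apply.
`linMap A` is a GRADED `k`-algebra automorphism: it commutes with taking homogeneous components (`homogeneousComponent_linMap`), hence preserves the order of every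
polynomial (`ordLE_linMap`), fixes the exceptional monomial `y^α`, and — being invertible with an inverse of the same kind — preserves «`N` has a monomial free of `y_n`»
(`X_dvd_iff_forall_ne`): so it transports residual decompositions (`isResidual_linMap`), slacks (same `α`, same defects) and the drop-point budget (`dropBudget_linChange`),
and the invariant `EquiTame` (`equiTame_linChange`). ★★★ `equiLinFibreChain_cap`: along chains whose steps are ω-permissible blow-ups followed by arbitrary fibre points
(K10j) OR linear re-coordinatisations fixing the exceptional letters, every stage with the drop-point budget has `ρ ≤ 8`. NOT COVERED (named, not this week): NON-LINEAR
smooth centres with SNC to `E` are coordinate subspaces only in re-chosen regular parameters of the complete local ring — a power-series `Stage` (`MvPowerSeries` letters,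
order instead of degree filtration, Weierstrass-prepared `P`) would be needed; the present polynomial letter model stops at affine-linear centres.
Exponent/coefficient bookkeeping only; no named fact.
-/

-- single-problem summit: the doubled namespace component is forced
set_option linter.dupNamespace false

noncomputable section

open MvPolynomial Finsupp
open Summit.ResolutionOfSingularities.ResolutionOfSingularities.Theorems.FInjectiveMacaulayfication.LastCentreDefs
open Summit.ResolutionOfSingularities.ResolutionOfSingularities.Theorems.FInjectiveMacaulayfication.LastCentreAxisOrder
open Summit.ResolutionOfSingularities.ResolutionOfSingularities.Theorems.FInjectiveMacaulayfication.LastCentreSlack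
open Summit.ResolutionOfSingularities.ResolutionOfSingularities.Theorems.FInjectiveMacaulayfication.LastCentreTame
open Summit.ResolutionOfSingularities.ResolutionOfSingularities.Theorems.FInjectiveMacaulayfication.LastCentreTranslate
open Summit.ResolutionOfSingularities.ResolutionOfSingularities.Theorems.FInjectiveMacaulayfication.LastCentreEquiChain
open Summit.ResolutionOfSingularities.ResolutionOfSingularities.Theorems.FInjectiveMacaulayfication.LastCentreFibre

namespace Summit.ResolutionOfSingularities.ResolutionOfSingularities.Theorems.FInjectiveMacaulayfication.LastCentreLinChange

variable {k : Type} [Field k]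

/-! ## 1. Linear letter substitutions -/

/-- THE LINEAR LETTER SUBSTITUTION `y_n ↦ Σ_m A n m · y_m`. [OURS · L1 W4.5a · definition; folklore] -/
def linMap (A : Letter → Letter → k) : YPoly k →ₐ[k] YPoly k :=
  aeval fun n => ∑ m : Letter, C (A n m) * X m

/-- `linMap A (y_n)`. [plumbing] -/
theorem linMap_X (A : Letter → Letter → k) (n : Letter) : linMap A (X n : YPoly k) = ∑ m : Letter, C (A n m) * X m :=
  aeval_X _ n

/-- The linear forms are homogeneous of degree `1`. [plumbing] -/
theorem isHomogeneous_linForm (A : Letter → Letter → k) (n : Letter) : (∑ m : Letter, C (A n m) * X m : YPoly k).IsHomogeneous 1 := by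
  refine IsHomogeneous.sum _ _ 1 fun m _ => ?_
  have := (isHomogeneous_C Letter (A n m)).mul (isHomogeneous_X k m)
  rwa [zero_add] at this

/-- `linMap A` IS GRADED: it maps homogeneous polynomials of degree `d` to homogeneous polynomials of degree `d`. [OURS · L1 W4.5a; folklore] -/
theorem isHomogeneous_linMap {G : YPoly k} {d : ℕ} (hG : G.IsHomogeneous d) (A : Letter → Letter → k) : (linMap A G).IsHomogeneous d := by
  have := hG.aeval (fun n => ∑ m : Letter, C (A n m) * X m) (fun i => isHomogeneous_linForm A i)
  rwa [one_mul] at this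

/-- TAKING THE DEGREE-`d` COMPONENT COMMUTES WITH `linMap A`. [OURS · L1 W4.5a; folklore] -/
theorem homogeneousComponent_linMap (A : Letter → Letter → k) (G : YPoly k) (d : ℕ) :
    homogeneousComponent d (linMap A G) = linMap A (homogeneousComponent d G) := by
  classical
  conv_lhs => rw [← sum_homogeneousComponent G, map_sum, map_sum]
  rw [Finset.sum_eq_single d]
  · exact homogeneousComponent_eq_self (isHomogeneous_linMap (homogeneousComponent_isHomogeneous d G) A)
  · intro j _ hne
    rw [homogeneousComponent_of_mem ((mem_homogeneousSubmodule j _).mpr (isHomogeneous_linMap (homogeneousComponent_isHomogeneous j G) A)),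
      if_neg (Ne.symm hne)]
  · intro hd
    rw [Finset.mem_range, not_lt] at hd
    rw [homogeneousComponent_eq_zero d G (by omega), map_zero, map_zero]

/-- `tdeg` is Mathlib's `Finsupp.degree`. [plumbing] -/
theorem tdeg_eq_degree (e : Expo) : tdeg e = e.degree := by
  rw [Finsupp.degree_eq_sum]; rfl

/-- ★ AN INVERTIBLE GRADED SUBSTITUTION PRESERVES THE ORDER: `ord₀ (linMap A G) ≤ m ⇔ ord₀ G ≤ m` (one direction; apply to the inverse for the other).
[OURS · L1 W4.5a; folklore] -/
theorem ordLE_linMap {A B : Letter → Letter → k} (hinv : ∀ G : YPoly k, linMap B (linMap A G) = G) {G : YPoly k} {m : ℕ}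
    (h : OrdLE G m) : OrdLE (linMap A G) m := by
  classical
  obtain ⟨e, he, hem⟩ := h
  have h1 : homogeneousComponent (tdeg e) G ≠ 0 := by
    rw [MvPolynomial.ne_zero_iff]
    refine ⟨e, ?_⟩
    rw [coeff_homogeneousComponent, if_pos (tdeg_eq_degree e).symm]
    exact MvPolynomial.mem_support_iff.mp he
  have h2 : homogeneousComponent (tdeg e) (linMap A G) ≠ 0 := by
    rw [homogeneousComponent_linMap]
    intro h0
    apply h1
    have := congrArg (linMap B) h0
    rwa [hinv, map_zero] at this
  obtain ⟨e', he'⟩ := MvPolynomial.ne_zero_iff.mp h2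
  rw [coeff_homogeneousComponent] at he'
  split_ifs at he' with hdeg
  · refine ⟨e', MvPolynomial.mem_support_iff.mpr he', ?_⟩
    rw [tdeg_eq_degree, hdeg]; exact hem
  · exact absurd rfl he'

/-- `y_n` DIVIDES `G` iff no monomial of `G` is free of `y_n`. [OURS · L1 W4.5a; folklore] -/
theorem X_dvd_iff_forall_ne {n : Letter} {G : YPoly k} : (X n : YPoly k) ∣ G ↔ ∀ e ∈ G.support, e n ≠ 0 := by
  classical
  rw [X_dvd_iff_modMonomial_eq_zero]
  constructor
  · intro h e he hen
    have := congrArg (coeff e) h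
    rw [coeff_modMonomial_of_not_le _ (by rw [Finsupp.single_le_iff]; omega), coeff_zero] at this
    exact (MvPolynomial.mem_support_iff.mp he) this
  · intro h
    ext e
    rw [coeff_zero]
    by_cases hle : Finsupp.single n 1 ≤ e
    · exact coeff_modMonomial_of_le _ hle
    · rw [coeff_modMonomial_of_not_le _ hle]
      by_contra hc
      exact hle (Finsupp.single_le_iff.mpr (Nat.one_le_iff_ne_zero.mpr (h e (MvPolynomial.mem_support_iff.mpr hc))))

/-- A substitution fixing the letters of `Exc` fixes the monomials in those letters. [plumbing] -/
theorem linMap_monomial_of_fix {A : Letter → Letter → k} {Exc : Finset Letter} (hfix : ∀ n ∈ Exc, linMap A (X n : YPoly k) = X n)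
    {α : Expo} (hα : ∀ n, n ∉ Exc → α n = 0) : linMap A (monomial α (1 : k)) = monomial α 1 := by
  classical
  rw [← prod_X_pow_eq_monomial, map_prod]
  refine Finset.prod_congr rfl fun n hn => ?_
  have hnE : n ∈ Exc := by
    by_contra h; exact (Finsupp.mem_support_iff.mp hn) (hα n h)
  rw [map_pow, hfix n hnE]

/-! ## 2. Residual decompositions, slacks and budgets under a linear change -/

/-- ★ RESIDUAL TRANSPORT UNDER AN INVERTIBLE LINEAR CHANGE FIXING THE EXCEPTIONAL LETTERS: `Disc = y^α·N ⇒ linMap A Disc = y^α·(linMap A N)` with the SAME `α`, and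
`linMap A N` still has a monomial free of each exceptional letter (else `y_n` would divide `N = linMap B (linMap A N)`). [OURS · L1 W4.5a] -/
theorem isResidual_linMap {A B : Letter → Letter → k} {Exc : Finset Letter} {D : YPoly k} {α : Expo} {N : YPoly k}
    (hfixA : ∀ n ∈ Exc, linMap A (X n : YPoly k) = X n) (hfixB : ∀ n ∈ Exc, linMap B (X n : YPoly k) = X n)
    (hinv : ∀ G : YPoly k, linMap B (linMap A G) = G) (h : IsResidual Exc D α N) : IsResidual Exc (linMap A D) α (linMap A N) := by
  obtain ⟨hD, hαoff, hNres⟩ := h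
  refine ⟨by rw [hD, map_mul, linMap_monomial_of_fix hfixA hαoff], hαoff, fun n hn => ?_⟩
  by_contra hno
  have hdvd : (X n : YPoly k) ∣ linMap A N := X_dvd_iff_forall_ne.mpr fun e he h0 => hno ⟨e, he, h0⟩
  have hdvdN : (X n : YPoly k) ∣ N := by
    have := map_dvd (linMap B) hdvd
    rwa [hfixB n hn, hinv] at this
  obtain ⟨e, he, hen⟩ := hNres n hn
  exact (X_dvd_iff_forall_ne.mp hdvdN) e he hen

/-- `S′` IS `S` IN LINEARLY CHANGED LETTERS: an invertible linear substitution `A` (inverse `B`) fixing every exceptional letter, `S′.D = linMap A S.D` (justified by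
`disc_map` + `disc_xshift`: change the letters in the coefficients and re-prepare `x`), same exceptional letters, same defects. [OURS · L1 W4.5a · definition] -/
def IsLinChange (S : Stage k) (A B : Letter → Letter → k) (S' : Stage k) : Prop :=
  (∀ n ∈ S.Exc, linMap A (X n : YPoly k) = X n) ∧ (∀ n ∈ S.Exc, linMap B (X n : YPoly k) = X n) ∧
    (∀ G : YPoly k, linMap B (linMap A G) = G) ∧ (∀ G : YPoly k, linMap A (linMap B G) = G) ∧
    S'.D = linMap A S.D ∧ S'.Exc = S.Exc ∧ ∀ n ∈ S'.Exc, S'.d n = S.d n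

/-- Every residual decomposition of `S′` is the image of one of `S` (same `α`). [OURS · L1 W4.5a] -/
theorem residual_of_linChange {S S' : Stage k} {A B : Letter → Letter → k} (h : IsLinChange S A B S') {α : Expo} {N : YPoly k}
    (hres : IsResidual S.Exc S.D α N) {α' : Expo} {N' : YPoly k} (hres' : IsResidual S'.Exc S'.D α' N') : α' = α ∧ N' = linMap A N := by
  obtain ⟨hfixA, hfixB, hinv, -, hD', hExc', -⟩ := h
  have h1 : IsResidual S'.Exc S'.D α (linMap A N) := by
    rw [hD', hExc']; exact isResidual_linMap hfixA hfixB hinv hres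
  obtain ⟨hαeq, hNeq⟩ := residual_unique hres' h1
  exact ⟨hαeq, hNeq⟩

/-- ★ THE DROP-POINT BUDGET IS INVARIANT under a linear change (it is an order condition on `Disc`; exceptional letters and defects are unchanged). [OURS · L1 W4.5a] -/
theorem dropBudget_linChange {S S' : Stage k} {A B : Letter → Letter → k} (h : IsLinChange S A B S') (hbud : DropBudget S') : DropBudget S := by
  obtain ⟨-, -, hinv, hinv', hD', hExc', hd'⟩ := h
  obtain ⟨f, hf, hfb⟩ := hbud
  have hsum : (∑ n ∈ S'.Exc, S'.d n) = ∑ n ∈ S.Exc, S.d n := by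
    rw [hExc']; exact Finset.sum_congr rfl fun n hn => hd' n (by rw [hExc']; exact hn)
  rw [hD'] at hf
  -- S.D = linMap B (S′.D): an order bound for S′.D transfers to S.D
  have hO' : OrdLE (linMap B (linMap A S.D)) (tdeg f) := ordLE_linMap hinv' ⟨f, hf, le_rfl⟩
  rw [hinv] at hO'
  obtain ⟨e, he, hle⟩ := hO'
  refine ⟨e, he, ?_⟩
  rw [← hsum]
  have : (tdeg e : ℤ) ≤ tdeg f := by exact_mod_cast hle
  exact this.trans hfb

/-- ★ `EquiTame` IS INVARIANT under a linear change: the residual order is preserved (graded automorphism) and the slacks are literally the same. [OURS · L1 W4.5a] -/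
theorem equiTame_linChange {S S' : Stage k} {A B : Letter → Letter → k} (h : IsLinChange S A B S') {α : Expo} {N : YPoly k}
    (hres : IsResidual S.Exc S.D α N) (hT : EquiTame S α N) {α' : Expo} {N' : YPoly k} (hres' : IsResidual S'.Exc S'.D α' N') :
    EquiTame S' α' N' := by
  obtain ⟨hαeq, hNeq⟩ := residual_of_linChange h hres hres'
  subst hαeq
  rw [hNeq]
  rcases hT with hle | hslack
  · left; exact ordLE_linMap h.2.2.1 hle
  · right
    exact allSlackLE_mono (by rw [h.2.2.2.2.2.1]) h.2.2.2.2.2.2 (fun _ _ => rfl) hslack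

/-- A linear change kills nothing: `S.D ≠ 0 ⇔ S′.D ≠ 0`. [plumbing] -/
theorem D_ne_zero_of_linChange {S S' : Stage k} {A B : Letter → Letter → k} (h : IsLinChange S A B S') (hD : S'.D ≠ 0) : S.D ≠ 0 := by
  intro hz; apply hD; rw [h.2.2.2.2.1, hz, map_zero]

/-! ## 3. Equi-ω chains with fibre points and linear re-coordinatisations -/

/-- EQUI-ω CHAINS WITH LINEAR RE-COORDINATISATIONS: steps are (i) an ω-permissible blow-up of a coordinate centre followed by the passage to an arbitrary point of the
exceptional fibre (K10j), or (ii) an invertible linear letter substitution fixing the exceptional letters (making the NEXT affine-linear centre a coordinate one).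
[OURS · L1 W4.5a · definition] -/
inductive EquiLinFibreReachable (S₀ : Stage k) : Stage k → Prop
  | refl : EquiLinFibreReachable S₀ S₀
  | step {S S' S'' : Stage k} (Nor : Finset Letter) (L : Letter) (α : Expo) (N : YPoly k) (ν : ℕ) (c : Letter → k) :
      EquiLinFibreReachable S₀ S → L ∈ Nor → IsChart S Nor L S' → IsResidual S.Exc S.D α N →
      (∃ e ∈ N.support, norDeg Nor e = ν) → (∀ e ∈ N.support, ν ≤ norDeg Nor e) → (∃ e ∈ N.support, tdeg e = ν) →
      IsTranslate S' c S'' → (∀ m, m ∉ Nor.erase L → c m = 0) → EquiLinFibreReachable S₀ S''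
  | lin {S S' : Stage k} (A B : Letter → Letter → k) :
      EquiLinFibreReachable S₀ S → IsLinChange S A B S' → EquiLinFibreReachable S₀ S'

/-- Along such a chain from an exceptional-free germ every residual decomposition of every stage with `D ≠ 0` is `EquiTame`. [OURS · plumbing] -/
theorem equiTame_of_equiLinFibreReachable {S₀ S : Stage k} (hExc : S₀.Exc = ∅) (h : EquiLinFibreReachable S₀ S) (hD : S.D ≠ 0)
    {α : Expo} {N : YPoly k} (hres : IsResidual S.Exc S.D α N) : EquiTame S α N := by
  induction h generalizing α N with
  | refl => right; intro n hn; rw [hExc] at hn; exact absurd hn (Finset.notMem_empty n)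
  | @step S S' S'' Nor L α₀ N₀ ν c _ hL hch hres₀ hν₁ hν₂ hequi htr hc ih =>
    have hD0 : S.D ≠ 0 := D_ne_zero_of_residual hres₀ (by obtain ⟨e, he, -⟩ := hν₁; exact ⟨e, he⟩)
    exact equiTame_fibre_step hL hch hres₀ hν₁ hν₂ hequi htr hc hres (ih hD0 hres₀)
  | @lin S S' A B _ hlc ih =>
    have hD0 : S.D ≠ 0 := D_ne_zero_of_linChange hlc hD
    obtain ⟨α₀, N₀, hres₀⟩ := LastCentreResidual.exists_isResidual S.Exc S.D hD0
    exact equiTame_linChange hlc hres₀ (ih hD0 hres₀) hres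

/-- ★★★ EQUI-ω CHAINS WITH FIBRE POINTS AND LINEAR RE-COORDINATISATIONS ARE TAME: from an exceptional-free germ, along any `EquiLinFibreReachable` chain, every stage
carrying the drop-point budget has `ρ ≤ 8` for every residual decomposition — the typed cap for ω-permissible rules whose centres are AFFINE-LINEAR in the current letters
at every image point (R26.47 (3): the linear part of gap (g1) closed; non-linear centres outside the polynomial letter model). [OURS · L1 W4.5a] -/
theorem equiLinFibreChain_cap {S₀ S : Stage k} (hExc : S₀.Exc = ∅) (hreach : EquiLinFibreReachable S₀ S) (hbud : DropBudget S)
    {α : Expo} {N : YPoly k} (hres : IsResidual S.Exc S.D α N) : OrdLE N 8 := by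
  have hD : S.D ≠ 0 := by
    rw [hres.1]
    refine mul_ne_zero (by rw [Ne, monomial_eq_zero]; exact one_ne_zero) fun hz => ?_
    obtain ⟨f, hf, -⟩ := hbud
    rw [hres.1, hz, mul_zero, MvPolynomial.support_zero] at hf
    exact Finset.notMem_empty f hf
  rcases equiTame_of_equiLinFibreReachable hExc hreach hD hres with hle | hslack
  · exact hle
  · exact ordLE_eight_of_allSlackLE_dropBudget hres hslack hbud

end Summit.ResolutionOfSingularities.ResolutionOfSingularities.Theorems.FInjectiveMacaulayfication.LastCentreLinChange

end
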